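import Literature.NumberTheory.DiophantineGeometry.AVIsogenyTateRationalEquivProofs
import Literature.NumberTheory.DiophantineGeometry.AVIsogenyTateInjectiveProofs
import Literature.NumberTheory.DiophantineGeometry.AVIsogenyTateFreeHomProofs
import Literature.NumberTheory.DiophantineGeometry.AVKernelHopf
import Literature.AlgebraicGeometry.Motives.TateAbelianFiniteLatticeProofs
import HarnessLib

/-!
# Route PhantomRMYoshida — FaltingsFinitenessI (item stmt-Langlands-15084), line `Sketch`: in characteristic `0` an isogeny is the quotient by its geometric kernel

Helper file for the line `Sketch` of the crux `PhantomRMYoshida.FaltingsFinitenessI`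
(item stmt-Langlands-15084, Faltings' Finiteness I over `ℚ` by counting geometric kernels inside
`A[N!](ℚ̄)`).  It supplies the step "same geometric kernel ⇒ isomorphic targets" of that line,
the registered stub `stub_exists_comp_eq_of_ker_geomPointsMap_le`:

  for an isogeny `g : A ⟶ B` of abelian varieties over a field `K` of characteristic `0` and a
  homomorphism `h : A ⟶ C` with `ker (g : A(K̄) → B(K̄)) ≤ ker (h : A(K̄) → C(K̄))`, there is
  `χ : B ⟶ C` with `χ ∘ g = h`;

i.e. the universal property of `g` as the quotient `A → A / Ker g` read on `K̄`-points.  The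
tree proves the scheme-theoretic universal property
(`IsIsogeny.exists_comp_eq_of_kerPoints_le_holds`, `AVIsogenyFlat`: `Ker g (T) ≤ Ker h (T)` for
all `K`-schemes `T` gives the factorisation); passing from `K̄`-points to `T`-points would need
`Ker g` to be étale (Cartier), which is not in the tree.  Instead the proof goes through the étale
isogeny `[M]`, `M = deg g = Hom.kerRank g`, exactly as in Milne, *Abelian Varieties* (1986),
§8 (Thm. 8.2 ff.: an isogeny of degree `M` divides `[M]`) and §12 (Lemma 12.6: a homomorphism
killing `A[M](K̄)`, `M` invertible in `K`, is divisible by `M` in `Hom`):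

1. `Ker g ⊆ A[M]` scheme-theoretically (Deligne; `IsIsogeny.kerPoints_le_kerPoints_nsmul`), so
   `[M]_A = f ∘ g` for an isogeny `f : B → A` (`IsIsogeny.exists_isogeny_comp_eq_nsmul_id`);
2. `φ := h ∘ f : B → C` kills `B[M](K̄)`: for `Q = g(P)` (`g` is onto on `K̄`-points,
   `IsIsogeny.geomPointsMap_surjective`) with `M Q = 0` one has `g(M P) = 0`, hence `h(M P) = 0`
   by the hypothesis, and `φ(Q) = h(f(g(P))) = h(M P) = 0`;
3. Milne's Lemma 12.6 (`exists_eq_nsmul_of_forall_geomTorsion`, using `char K = 0`) gives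
   `h ∘ f = M χ` for some `χ : B → C`;
4. `M (χ ∘ g) = (M χ) ∘ g = h ∘ f ∘ g = h ∘ [M]_A = M h`, and `Hom(A, C)` is torsion-free
   (`eq_zero_of_zsmul_eq_zero_of_cast_ne_zero`, Milne Lemma 12.2), so `χ ∘ g = h`.

* `stub_exists_comp_eq_of_ker_geomPointsMap_le` — the registered stub, verbatim;
* `exists_comp_eq_of_ker_geomPointsMap_le` — the same statement under its descriptive name
  (isogeny hypothesis first, `g` implicit).

Pure-proof file, no definitions, no new named facts.
-/

set_option linter.dupNamespace false -- as in the sibling Theorems files: `Summit.Langlands.Langlands` is the mandated namespace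

noncomputable section

open CategoryTheory
open Literature.AlgebraicGeometry.Motives
open Literature.AlgebraicGeometry.Motives.AbelianVariety

universe u

namespace Summit.Langlands.Langlands.Theorems.PhantomRMYoshida

/-- **In characteristic `0` an isogeny is the quotient by its geometric kernel** (registered stub
of the line `Sketch` of item stmt-Langlands-15084): for an isogeny `g : A → B` of abelian
varieties over a field `K` of characteristic `0` and a homomorphism `h : A → C` with
`ker (A(K̄) → B(K̄)) ≤ ker (A(K̄) → C(K̄))`, there is `χ : B → C` with `g ≫ χ = h`.
Proof (Milne 1986, §8 and Lemma 12.6): with `M = deg g = Hom.kerRank g`, `Ker g ⊆ A[M]`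
scheme-theoretically (`IsIsogeny.kerPoints_le_kerPoints_nsmul`), so `g ≫ f = [M]_A` for some
`f : B → A` (`IsIsogeny.exists_isogeny_comp_eq_nsmul_id`); `f ≫ h` kills `B[M](K̄) = g(M⁻¹ ker)`
(`IsIsogeny.geomPointsMap_surjective` and the hypothesis), hence `f ≫ h = M • χ`
(`exists_eq_nsmul_of_forall_geomTorsion`, Milne's Lemma 12.6); finally
`M • (g ≫ χ) = g ≫ f ≫ h = [M]_A ≫ h = M • h` and `Hom(A, C)` is torsion-free
(`eq_zero_of_zsmul_eq_zero_of_cast_ne_zero`). [cite: Milne1986AbelianVarieties, Lemma 12.6] -/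
theorem stub_exists_comp_eq_of_ker_geomPointsMap_le {K : Type u} [Field K] [CharZero K]
    {A B C : AbelianVariety K} (g : A ⟶ B) (hg : IsIsogeny g) (h : A ⟶ C)
    (hle : (Hom.geomPointsMap g).ker ≤ (Hom.geomPointsMap h).ker) :
    ∃ χ : B ⟶ C, g ≫ χ = h := by
  -- (1) `M := deg g = kerRank g` is positive, hence invertible in `K` (characteristic `0`)
  haveI := hg.2
  have hMK : ((Hom.kerRank g : ℕ) : K) ≠ 0 := Nat.cast_ne_zero.mpr (Hom.kerRank_pos g).ne'
  -- (2)–(3) `Ker g ⊆ A[M]` scheme-theoretically, so `g ≫ f = [M]_A` for an isogeny `f : B ⟶ A`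
  obtain ⟨f, -, hgf, -⟩ :=
    hg.exists_isogeny_comp_eq_nsmul_id hMK hg.kerPoints_le_kerPoints_nsmul
  -- on `K̄`-points: `f (g P) = M • P`
  have hfg : ∀ P : A.geomPoints,
      Hom.geomPointsMap f (Hom.geomPointsMap g P) = Hom.kerRank g • P := fun P ↦ by
    rw [← AddMonoidHom.comp_apply (Hom.geomPointsMap f) (Hom.geomPointsMap g) P,
      ← Hom.geomPointsMap_comp, hgf, geomPointsMap_nsmul_apply, Hom.geomPointsMap_id,
      AddMonoidHom.id_apply]
  -- (4) `φ := f ≫ h` kills `B[M](K̄)`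
  have hφ : ∀ Q ∈ B.geomTorsion (Hom.kerRank g : ℕ), Hom.geomPointsMap (f ≫ h) Q = 0 := by
    intro Q hQ
    obtain ⟨P, rfl⟩ := hg.geomPointsMap_surjective Q
    -- `M • g(P) = 0`, i.e. `g (M • P) = 0`, hence `h (M • P) = 0`
    rw [mem_geomTorsion_iff', natCast_zsmul, ← map_nsmul] at hQ
    have hMP : Hom.geomPointsMap h (Hom.kerRank g • P) = 0 := hle hQ
    rw [Hom.geomPointsMap_comp, AddMonoidHom.comp_apply, hfg, hMP]
  -- (5) Milne 1986, Lemma 12.6: `f ≫ h = M • χ`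
  obtain ⟨χ, hχ⟩ := exists_eq_nsmul_of_forall_geomTorsion (Hom.kerRank g) hMK (f ≫ h) hφ
  refine ⟨χ, ?_⟩
  -- (6) `M • (g ≫ χ) = g ≫ f ≫ h = [M]_A ≫ h = M • h`, and `Hom(A, C)` is torsion-free
  have key : (Hom.kerRank g : ℤ) • (g ≫ χ - h) = 0 := by
    rw [smul_sub, sub_eq_zero, ← Preadditive.comp_zsmul, ← hχ, ← Category.assoc, hgf,
      Preadditive.nsmul_comp, Category.id_comp, natCast_zsmul]
  exact sub_eq_zero.mp
    (eq_zero_of_zsmul_eq_zero_of_cast_ne_zero (n := (Hom.kerRank g : ℤ))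
      (by rwa [Int.cast_natCast]) key)

/-- **In characteristic `0` an isogeny is the quotient by its geometric kernel** (descriptive
name of the stub `stub_exists_comp_eq_of_ker_geomPointsMap_le`): for an isogeny `g : A → B` of
abelian varieties over a field `K` of characteristic `0`, every homomorphism `h : A → C` whose
kernel on `K̄`-points contains that of `g` factors uniquely-up-to-existence through `g`:
there is `χ : B → C` with `g ≫ χ = h` (Milne 1986, §8 with Lemma 12.6: `g` divides `[deg g]`,
and a homomorphism killing `B[deg g](K̄)` is divisible by `deg g`).
[cite: Milne1986AbelianVarieties, Lemma 12.6] -/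
theorem exists_comp_eq_of_ker_geomPointsMap_le {K : Type u} [Field K] [CharZero K]
    {A B C : AbelianVariety K} {g : A ⟶ B} (hg : IsIsogeny g) (h : A ⟶ C)
    (hle : (Hom.geomPointsMap g).ker ≤ (Hom.geomPointsMap h).ker) :
    ∃ χ : B ⟶ C, g ≫ χ = h :=
  stub_exists_comp_eq_of_ker_geomPointsMap_le g hg h hle

end Summit.Langlands.Langlands.Theorems.PhantomRMYoshida

end
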